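import Summits.QuantumFields.YangMills.Theorems.IR.RunningLandmarkDefs
import Summits.QuantumFields.YangMills.Theorems.BalabanLadderIRColdPurityBridgeSpectral
import Summits.QuantumFields.YangMills.Theorems.BalabanLadderIRRankPurityDefs
import HarnessLib

/-!
# Lens 4/4 «SPECTRAL ∕ STOCHASTIC» on crux `IRcof` (stmt-QuantumFields-26930) — FIRST LEMMAS of the crux idea
# «lipschitz-vacuum-transport» (ideator ymfull-r2c-lens-4 g0; sketch — ZERO sorries since v2.3)
# v2 2026-08-30T20:35Z — CUT-1 ANSWER: §2's T-DOM conceded COSTUME (critic's `towerDominated_of_pinnedExitsCofinal`); §3 re-types the piece as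
# LEVEL-WISE DOMINATION `LevelwiseDominatedCofinal` over the tree idiom `IsRatioDatum`, with the chain LW-DOM ⇒ T-DOM ⇒ PXcof(1/24) KERNEL-CHECKED, no sorry (v2.3).
# v2.3 20:35Z+ — LEMMA A PROVED (`gaussTowerExcess_small`: Jordan on the torus, relativistic dispersion bound, (1−y)⁻¹ ≤ e^{2y},
# lattice sum uniform in L): the sheet has ZERO sorries; `pinnedExitsCofinal_of_levelwise : LevelwiseDominatedCofinal → PinnedExitsCofinalAt (1/24)`
# is KERNEL-CLEAN (axioms propext ∕ Classical.choice ∕ Quot.sound).  LW-DOM ⇒ PXcof is thus CERTIFIED; that PXcof ⇏ LW-DOM by kernel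
# bookkeeping (non-costume) is ARGUED in §3's docstring, not certified — the critic's probe decides.
# v2.2 20:35Z — lemma B (spectral bookkeeping) AND lemma B1 (multi-geometric series, via `hasSum_pi_geometric`) PROVED: the chain
# LW-DOM ⇒ T-DOM is KERNEL-CLEAN (`towerDominated_of_levelwise`, axioms propext/Classical.choice/Quot.sound) and LW-DOM ⇒ PXcof(1/24)
# held modulo lemma A at v2.2 (superseded: lemma A proved in v2.3).

bears_on: R2c `BalabanLadder.IRcof` via the slot of record `Cruxes/IRcof/Lines/pinned_cofinal_bill.lean`
(`stub_pinnedExitsCofinal : PXcof(1/24)`).  HONEST: finite-volume ∕ conditional; nothing here proves PXcof, `IRcof`,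
`IR`, a lattice gap or the Yang–Mills mass gap (Clay) — NOT proved.

THE IDEA IN ONE LINE.  Purity of the `4:1` cold torus is a statement about the WHOLE thermal tower
`x_t(L) = Σ_{i≥1} (λᵢ/λ₀)^t`, `t = ⌊L/4⌋`, not about the gap: momentum-blind functional inequalities (Poincaré ∕ LSI ∕
Nash ∕ sup-start mixing) pay `log(#dof) = 3 log(T/a(β)) → ∞` cofinally (barrier note B-ENTROPY), so the reference must carry
a DISPERSION.  Lever: a Lipschitz transport map from the lattice massive Gaussian `γ_{M,ω_m}` (mass `m = μ·a(β)` in the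
floor's unit) onto the Doob vacuum measure `π_{β,L} = Ω₊² · Haar` of the torus transfer matrix (Caffarelli contraction in
Zwanziger's convex Coulomb chart, where `−log det(FP)` is convex for free because the Faddeev–Popov operator is affine;
or Kim–Milman ∕ Mikulincer–Shenfeld heat-flow maps) makes EVERY Doob eigenvalue dominate the corresponding free one
(E. Milman, «Spectral estimates, contractions and hypercontractivity», J. Spectral Theory 8 (2018)), hence
`x_t(L) ≤` the free massive tower `gaussTowerExcess` — which at aspect `L/t = 4` is uniformly small once `t·m ≳ A`
(bounded «relativistic entropy», `gaussTowerExcess_small`).  The typed hypothesis `TowerDominatedCofinal` (T-DOM) is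
the transfer of PXcof to this spectral-domination form; `pinnedExitsCofinal_of_towerDominated` is the KERNEL-CHECKED seam
T-DOM ⇒ PXcof(1/24) over the tree's `one_sub_ratio_le_two_mul_traceExcess` (`δᶜ ≤ 2x_t`).
-/

set_option autoImplicit false

noncomputable section

open Filter Topology MeasureTheory
open scoped BigOperators
open Literature.MathematicalPhysics.QuantumFieldTheory Literature.MathematicalPhysics.QuantumLattice
open Summit.QuantumFields.YangMills.Cruxes.OSLegsFromFemtoAndGap.DlrCollarTransfer (LowerBounds)
open Summit.QuantumFields.YangMills.Cruxes.IR.ColdPurityBridge (coldDefect one_sub_ratio_le_two_mul_traceExcess)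
open Summit.QuantumFields.YangMills.Cruxes.IRcof.RunningLandmark (PinnedExitsCofinalAt)
open Summit.QuantumFields.YangMills.Cruxes.IR.RankPurity (IsRatioDatum exists_ratioDatum)

namespace Summit.QuantumFields.YangMills.Cruxes.IRcof.Lens4Spectral

/-! ## §1 The reference tower: `d` species of free lattice bosons with dispersion `ω(k) = √(m² + c²·k̂²)` (pure real analysis) -/

/-- Lattice dispersion `ω_{m,c}(k) = √(m² + c² Σ_j (2 sin(π k_j/L))²)` on the spatial torus `(ℤ/L)³`
(`c ∈ (0,1]` = a «speed of light» margin absorbing the UV deficit `ω_k(0) < ω_k(m)` of the perturbative Hessian). -/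
def latticeDispersion (m c : ℝ) (L : ℕ) (k : Fin 3 → Fin L) : ℝ :=
  Real.sqrt (m ^ 2 + c ^ 2 * ∑ j : Fin 3, (2 * Real.sin (Real.pi * ((k j : ℕ) : ℝ) / L)) ^ 2)

/-- **Free massive tower.**  Thermal trace excess of `d` species of free lattice bosons on `L³` at Euclidean time `t`:
`Π_k (1 − e^{−t ω(k)})^{−d} − 1 = Σ_{occupation numbers ≠ 0} e^{−t Σ_k n_k ω(k)}` — the spectrum of the Langevin
generator of the Gaussian `γ_{M,ω}` read through the Doob dictionary. -/
def gaussTowerExcess (d : ℕ) (m c : ℝ) (L t : ℕ) : ℝ :=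
  (∏ k : Fin 3 → Fin L, (1 - Real.exp (-((t : ℝ) * latticeDispersion m c L k)))⁻¹) ^ d - 1

/-- `m ≤ ω(k)` for `m ≥ 0` (copy of `mass_le_latticeDispersion'` of §3, needed here in §1). -/
theorem mass_le_latticeDispersion₀ {m : ℝ} (hm : 0 ≤ m) (c : ℝ) (L : ℕ) (k : Fin 3 → Fin L) :
    m ≤ latticeDispersion m c L k := by
  unfold latticeDispersion
  calc m = Real.sqrt (m ^ 2) := (Real.sqrt_sq hm).symm
    _ ≤ Real.sqrt (m ^ 2 + c ^ 2 * ∑ j : Fin 3, (2 * Real.sin (Real.pi * ((k j : ℕ) : ℝ) / L)) ^ 2) := by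
        apply Real.sqrt_le_sqrt
        have : 0 ≤ c ^ 2 * ∑ j : Fin 3, (2 * Real.sin (Real.pi * ((k j : ℕ) : ℝ) / L)) ^ 2 := by positivity
        linarith

/-- `(1 − y)⁻¹ ≤ e^{2y}` on `[0, 1/2]` (algebra + `1 + x ≤ eˣ`). -/
theorem inv_one_sub_le_exp {y : ℝ} (hy0 : 0 ≤ y) (hy : y ≤ 1 / 2) : (1 - y)⁻¹ ≤ Real.exp (2 * y) := by
  have h1 : 0 < 1 - y := by linarith
  calc (1 - y)⁻¹ ≤ 1 + 2 * y := by
        rw [inv_eq_one_div, div_le_iff₀ h1]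
        nlinarith
    _ ≤ Real.exp (2 * y) := by linarith [Real.add_one_le_exp (2 * y)]

/-- Jordan's inequality on the discrete torus: `2·dist(n, Lℤ)/L ≤ sin(π n/L)` for `0 ≤ n < L`. -/
theorem torus_sin_lower (L n : ℕ) (hL : 0 < L) (hn : n < L) :
    2 * ((min n (L - n) : ℕ) : ℝ) / L ≤ Real.sin (Real.pi * (n : ℝ) / L) := by
  have hLr : (0 : ℝ) < L := by exact_mod_cast hL
  have hpi := Real.pi_pos
  rcases le_or_gt n (L - n) with h | h
  · rw [min_eq_left h]
    have h2 : 2 * (n : ℝ) ≤ L := by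
      have : 2 * n ≤ L := by omega
      exact_mod_cast this
    have hx0 : 0 ≤ Real.pi * (n : ℝ) / L := by positivity
    have hx1 : Real.pi * (n : ℝ) / L ≤ Real.pi / 2 := by
      rw [div_le_div_iff₀ hLr (by norm_num : (0:ℝ) < 2)]
      nlinarith
    have e : 2 / Real.pi * (Real.pi * (n : ℝ) / L) = 2 * (n : ℝ) / L := by
      field_simp
    rw [← e]
    exact Real.mul_le_sin hx0 hx1
  · rw [min_eq_right h.le]
    have hcast : ((L - n : ℕ) : ℝ) = (L : ℝ) - n := Nat.cast_sub hn.le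
    have hnL : (n : ℝ) ≤ L := by exact_mod_cast hn.le
    have h2 : 2 * ((L : ℝ) - n) ≤ L := by
      have h' : 2 * (L - n) ≤ L := by omega
      have h'' : ((2 * (L - n) : ℕ) : ℝ) ≤ L := by exact_mod_cast h'
      push_cast [Nat.cast_sub hn.le] at h''
      linarith
    have hx0 : 0 ≤ Real.pi * ((L : ℝ) - n) / L :=
      div_nonneg (mul_nonneg hpi.le (by linarith)) hLr.le
    have hx1 : Real.pi * ((L : ℝ) - n) / L ≤ Real.pi / 2 := by
      rw [div_le_div_iff₀ hLr (by norm_num : (0:ℝ) < 2)]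
      nlinarith
    have hsin : Real.sin (Real.pi * (n : ℝ) / L) = Real.sin (Real.pi * ((L : ℝ) - n) / L) := by
      rw [← Real.sin_pi_sub]
      congr 1
      field_simp
    have e : 2 / Real.pi * (Real.pi * ((L : ℝ) - n) / L) = 2 * ((L : ℝ) - n) / L := by
      field_simp
    rw [hsin, hcast, ← e]
    exact Real.mul_le_sin hx0 hx1

/-- The sines in the dispersion are nonnegative (`0 ≤ π k_j / L < π`). -/
theorem torus_sin_nonneg (L : ℕ) (n : Fin L) : 0 ≤ Real.sin (Real.pi * ((n : ℕ) : ℝ) / L) := by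
  have hL : 0 < L := Fin.pos n
  have hLr : (0 : ℝ) < L := by exact_mod_cast hL
  have hn : ((n : ℕ) : ℝ) ≤ L := by exact_mod_cast (le_of_lt n.isLt)
  refine Real.sin_nonneg_of_nonneg_of_le_pi (by positivity) ?_
  rw [div_le_iff₀ hLr]
  nlinarith [Real.pi_pos]

/-- **Relativistic lower bound on the dispersion:** `ω(k) ≥ (m + (c/3)·Σ_j 2 sin(π k_j/L))/2`
(`√(m² + c²Σ s_j²) ≥ √(m² + c² max_j s_j²) ≥ (m + c·max_j s_j)/√2`, and `max ≥ mean`). -/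
theorem latticeDispersion_lower {m c : ℝ} (hm : 0 ≤ m) (hc : 0 ≤ c) (L : ℕ) (k : Fin 3 → Fin L) :
    (m + c / 3 * ∑ j : Fin 3, 2 * Real.sin (Real.pi * ((k j : ℕ) : ℝ) / L)) / 2 ≤ latticeDispersion m c L k := by
  unfold latticeDispersion
  set s : Fin 3 → ℝ := fun j => 2 * Real.sin (Real.pi * ((k j : ℕ) : ℝ) / L) with hs
  have hs0 : ∀ j, 0 ≤ s j := fun j => mul_nonneg (by norm_num) (torus_sin_nonneg L (k j))
  have hsum : ∑ j : Fin 3, s j = s 0 + s 1 + s 2 := Fin.sum_univ_three s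
  have hsum2 : ∑ j : Fin 3, s j ^ 2 = s 0 ^ 2 + s 1 ^ 2 + s 2 ^ 2 := Fin.sum_univ_three (fun j => s j ^ 2)
  change (m + c / 3 * ∑ j : Fin 3, s j) / 2 ≤ Real.sqrt (m ^ 2 + c ^ 2 * ∑ j : Fin 3, s j ^ 2)
  rw [hsum, hsum2]
  have h0 := hs0 0
  have h1 := hs0 1
  have h2 := hs0 2
  have hL0 : 0 ≤ (m + c / 3 * (s 0 + s 1 + s 2)) / 2 := by positivity
  refine Real.le_sqrt_of_sq_le ?_
  nlinarith [sq_nonneg (m - c / 3 * (s 0 + s 1 + s 2)), mul_nonneg (sq_nonneg c) (sq_nonneg (s 0 - s 1)),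
    mul_nonneg (sq_nonneg c) (sq_nonneg (s 1 - s 2)), mul_nonneg (sq_nonneg c) (sq_nonneg (s 0 - s 2)),
    sq_nonneg c, mul_nonneg (sq_nonneg c) (sq_nonneg (s 0 + s 1 + s 2))]

/-- One-dimensional torus weight `w(n) = e^{−a·dist(n, Lℤ)}` and its sum bound `Σ_{n<L} w(n) ≤ 2(1 − e^{−a})⁻¹`. -/
theorem torus_weight_sum_le (a : ℝ) (ha : 0 < a) (L : ℕ) :
    ∑ n : Fin L, Real.exp (-(a * ((min (n : ℕ) (L - n) : ℕ) : ℝ))) ≤ 2 * (1 - Real.exp (-a))⁻¹ := by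
  set r : ℝ := Real.exp (-a) with hr
  have hr0 : 0 ≤ r := (Real.exp_pos _).le
  have hr1 : r < 1 := by
    rw [hr]
    exact lt_of_lt_of_eq (Real.exp_lt_exp.2 (by linarith : -a < 0)) Real.exp_zero
  have hgeom : HasSum (fun n : ℕ => r ^ n) (1 - r)⁻¹ := hasSum_geometric_of_lt_one hr0 hr1
  have hpart : ∀ N, ∑ n ∈ Finset.range N, r ^ n ≤ (1 - r)⁻¹ :=
    fun N => sum_le_hasSum (Finset.range N) (fun n _ => pow_nonneg hr0 n) hgeom
  -- `e^{−a j} = r^j`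
  have hexp : ∀ j : ℕ, Real.exp (-(a * (j : ℝ))) = r ^ j := by
    intro j
    rw [hr, ← Real.exp_nat_mul]
    congr 1
    ring
  -- termwise: `w(n) ≤ r^n + r^(L-n)`
  have hterm : ∀ n : ℕ, n < L →
      Real.exp (-(a * ((min n (L - n) : ℕ) : ℝ))) ≤ r ^ n + r ^ (L - n) := by
    intro n hn
    rcases le_or_gt n (L - n) with h | h
    · rw [min_eq_left h, hexp]
      linarith [pow_nonneg hr0 (L - n)]
    · rw [min_eq_right h.le, hexp]
      linarith [pow_nonneg hr0 n]
  calc ∑ n : Fin L, Real.exp (-(a * ((min (n : ℕ) (L - n) : ℕ) : ℝ)))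
      = ∑ n ∈ Finset.range L, Real.exp (-(a * ((min n (L - n) : ℕ) : ℝ))) :=
        Fin.sum_univ_eq_sum_range (fun n => Real.exp (-(a * ((min n (L - n) : ℕ) : ℝ)))) L
    _ ≤ ∑ n ∈ Finset.range L, (r ^ n + r ^ (L - n)) :=
        Finset.sum_le_sum fun n hn => hterm n (Finset.mem_range.1 hn)
    _ = ∑ n ∈ Finset.range L, r ^ n + ∑ n ∈ Finset.range L, r ^ (L - n) := Finset.sum_add_distrib
    _ ≤ (1 - r)⁻¹ + (1 - r)⁻¹ := by
        refine add_le_add (hpart L) ?_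
        -- reflect: `Σ_{n<L} r^{L-n} = Σ_{j<L} r^{j+1} ≤ Σ_{j<L} r^j`
        have hrefl : ∑ n ∈ Finset.range L, r ^ (L - n) = ∑ j ∈ Finset.range L, r ^ (j + 1) := by
          rw [← Finset.sum_range_reflect (fun j => r ^ (j + 1)) L]
          refine Finset.sum_congr rfl fun n hn => ?_
          have hn' := Finset.mem_range.1 hn
          congr 1
          omega
        rw [hrefl]
        calc ∑ j ∈ Finset.range L, r ^ (j + 1) ≤ ∑ j ∈ Finset.range L, r ^ j :=
              Finset.sum_le_sum fun j _ => by
                rw [pow_succ]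
                exact mul_le_of_le_one_right (pow_nonneg hr0 j) hr1.le
          _ ≤ (1 - r)⁻¹ := hpart L
    _ = 2 * (1 - r)⁻¹ := by ring

/-- `e^{−2} ≤ 1/2` (from `1 + x ≤ eˣ`). -/
theorem exp_neg_two_le_half : Real.exp (-2) ≤ 1 / 2 := by
  have h : (3 : ℝ) ≤ Real.exp 2 := by linarith [Real.add_one_le_exp (2 : ℝ)]
  rw [Real.exp_neg, inv_eq_one_div, div_le_div_iff₀ (Real.exp_pos 2) (by norm_num : (0:ℝ) < 2)]
  linarith

/-- **FIRST LEMMA A (real analysis, KERNEL since v2.3).**  At the cold aspect `t = ⌊L/4⌋` the free massive tower is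
uniformly small once `m·t ≥ A(d, c, ε)`: the «relativistic entropy» is bounded, so NO `log L³` is paid (contrast: a
momentum-blind bound `N·e^{−tλ₁}` has `N ~ L³`).  Proof: `(1−y)⁻¹ ≤ e^{2y}` for `y = e^{−tω(k)} ≤ e^{−tm} ≤ 1/2`, so
`Π_k (1−y_k)^{−d} ≤ exp(2d Σ_k y_k)`; the relativistic bound `ω(k) ≥ (m + (c/3)Σ_j 2 sin(πk_j/L))/2`, Jordan
`2 sin(πn/L) ≥ 4 dist(n,Lℤ)/L` and `t ≥ L/8` give `y_k ≤ e^{−tm/2} Π_j e^{−(c/12) dist(k_j, Lℤ)}`, whose lattice sum is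
`≤ e^{−tm/2}·(2(1−e^{−c/12})⁻¹)³` UNIFORMLY IN `L`; finally `eᶻ − 1 ≤ 2z` for `z ≤ 1`. -/
theorem gaussTowerExcess_small (d : ℕ) (c : ℝ) (hc : 0 < c) (ε : ℝ) (hε : 0 < ε) :
    ∃ A : ℝ, ∀ (L : ℕ) (m : ℝ), 8 ≤ L → 0 ≤ m → A ≤ m * ((L / 4 : ℕ) : ℝ) →
      gaussTowerExcess d m c L (L / 4) ≤ ε := by
  classical
  -- constants
  set a : ℝ := c / 12 with ha_def
  have ha : 0 < a := by rw [ha_def]; positivity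
  set B₁ : ℝ := 2 * (1 - Real.exp (-a))⁻¹ with hB₁
  have hB₁0 : 0 < B₁ := by
    have : Real.exp (-a) < 1 := lt_of_lt_of_eq (Real.exp_lt_exp.2 (by linarith : -a < 0)) Real.exp_zero
    rw [hB₁]
    have : 0 < 1 - Real.exp (-a) := by linarith
    positivity
  set B : ℝ := B₁ ^ 3 with hB
  have hB0 : 0 < B := by rw [hB]; positivity
  set K : ℝ := 2 * d * B + 1 with hK
  have hK0 : 0 < K := by rw [hK]; positivity
  set ε' : ℝ := min ε 1 with hε'
  have hε'0 : 0 < ε' := by rw [hε']; exact lt_min hε one_pos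
  have hε'ε : ε' ≤ ε := min_le_left _ _
  have hε'1 : ε' ≤ 1 := min_le_right _ _
  set A : ℝ := max 2 (2 * Real.log (4 * K / ε')) with hA_def
  refine ⟨A, fun L m hL hm hA => ?_⟩
  -- the cold time
  set t : ℕ := L / 4 with ht_def
  have ht8 : L ≤ 8 * t := by omega
  have hLpos : 0 < L := by omega
  have hLr : (0 : ℝ) < L := by exact_mod_cast hLpos
  have htr : (L : ℝ) ≤ 8 * (t : ℝ) := by exact_mod_cast ht8
  have ht0 : (0 : ℝ) ≤ t := Nat.cast_nonneg _
  have hA2 : 2 ≤ A := le_max_left _ _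
  have hAlog : 2 * Real.log (4 * K / ε') ≤ A := le_max_right _ _
  have hmt : 2 ≤ m * t := le_trans hA2 hA
  -- the modes
  set y : (Fin 3 → Fin L) → ℝ := fun k => Real.exp (-((t : ℝ) * latticeDispersion m c L k)) with hy_def
  have hy0 : ∀ k, 0 ≤ y k := fun k => (Real.exp_pos _).le
  have hy_half : ∀ k, y k ≤ 1 / 2 := by
    intro k
    have hω : m ≤ latticeDispersion m c L k := mass_le_latticeDispersion₀ hm c L k
    calc y k ≤ Real.exp (-(m * t)) := by
          apply Real.exp_le_exp.2
          nlinarith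
      _ ≤ Real.exp (-2) := Real.exp_le_exp.2 (by linarith)
      _ ≤ 1 / 2 := exp_neg_two_le_half
  -- per-coordinate weight
  set w : Fin L → ℝ := fun n => Real.exp (-(a * ((min (n : ℕ) (L - n) : ℕ) : ℝ))) with hw_def
  have hw0 : ∀ n, 0 ≤ w n := fun n => (Real.exp_pos _).le
  have hwsum : ∑ n : Fin L, w n ≤ B₁ := torus_weight_sum_le a ha L
  -- STEP 2a: `y k ≤ e^{−tm/2} Π_j w(k j)`
  have hy_le : ∀ k, y k ≤ Real.exp (-(m * t / 2)) * ∏ j : Fin 3, w (k j) := by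
    intro k
    have hdisp := latticeDispersion_lower hm hc.le L k
    -- Jordan per coordinate: `a·dist ≤ t·(c/3)·2 sin/2`
    have hcoord : ∀ j : Fin 3,
        a * ((min ((k j : ℕ)) (L - (k j : ℕ)) : ℕ) : ℝ) ≤ (t : ℝ) * (c / 3 * (2 * Real.sin (Real.pi * ((k j : ℕ) : ℝ) / L))) / 2 := by
      intro j
      have hJ := torus_sin_lower L (k j) hLpos (k j).isLt
      -- `2·dist/L ≤ sin`, so `t·(c/3)·sin ≥ (L/8)(c/3)(2 dist/L) = (c/12)·dist = a·dist`
      have hdist0 : (0 : ℝ) ≤ ((min ((k j : ℕ)) (L - (k j : ℕ)) : ℕ) : ℝ) := Nat.cast_nonneg _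
      have h1 : 2 * ((min ((k j : ℕ)) (L - (k j : ℕ)) : ℕ) : ℝ) ≤ (L : ℝ) * Real.sin (Real.pi * ((k j : ℕ) : ℝ) / L) := by
        have := (div_le_iff₀ hLr).1 hJ
        linarith
      rw [ha_def]
      have hsin0 : 0 ≤ Real.sin (Real.pi * ((k j : ℕ) : ℝ) / L) := torus_sin_nonneg L (k j)
      nlinarith [mul_le_mul_of_nonneg_right htr (mul_nonneg hc.le hsin0)]
    have hsumcoord : ∑ j : Fin 3, a * ((min ((k j : ℕ)) (L - (k j : ℕ)) : ℕ) : ℝ)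
        ≤ ∑ j : Fin 3, (t : ℝ) * (c / 3 * (2 * Real.sin (Real.pi * ((k j : ℕ) : ℝ) / L))) / 2 :=
      Finset.sum_le_sum fun j _ => hcoord j
    have hrhs : ∑ j : Fin 3, (t : ℝ) * (c / 3 * (2 * Real.sin (Real.pi * ((k j : ℕ) : ℝ) / L))) / 2
        = (t : ℝ) * (c / 3 * ∑ j : Fin 3, 2 * Real.sin (Real.pi * ((k j : ℕ) : ℝ) / L)) / 2 := by
      rw [Finset.mul_sum, Finset.mul_sum, Finset.sum_div]
    have hexp_arg : -((t : ℝ) * latticeDispersion m c L k)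
        ≤ -(m * t / 2) + ∑ j : Fin 3, (-(a * ((min ((k j : ℕ)) (L - (k j : ℕ)) : ℕ) : ℝ))) := by
      rw [Finset.sum_neg_distrib]
      have h1 := mul_le_mul_of_nonneg_left hdisp ht0
      have h2 : (t : ℝ) * ((m + c / 3 * ∑ j : Fin 3, 2 * Real.sin (Real.pi * ((k j : ℕ) : ℝ) / L)) / 2)
          = m * t / 2 + (t : ℝ) * (c / 3 * ∑ j : Fin 3, 2 * Real.sin (Real.pi * ((k j : ℕ) : ℝ) / L)) / 2 := by ring
      linarith
    calc y k = Real.exp (-((t : ℝ) * latticeDispersion m c L k)) := rfl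
      _ ≤ Real.exp (-(m * t / 2) + ∑ j : Fin 3, (-(a * ((min ((k j : ℕ)) (L - (k j : ℕ)) : ℕ) : ℝ)))) :=
          Real.exp_le_exp.2 hexp_arg
      _ = Real.exp (-(m * t / 2)) * ∏ j : Fin 3, w (k j) := by
          rw [Real.exp_add, Real.exp_sum]
  -- STEP 2b: lattice sum, uniformly in `L`
  have hprodsum : ∑ k : Fin 3 → Fin L, ∏ j : Fin 3, w (k j) = (∑ n : Fin L, w n) ^ 3 := by
    have h := Finset.sum_prod_piFinset (Finset.univ : Finset (Fin L)) (fun (_ : Fin 3) (n : Fin L) => w n)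
    rw [Fintype.piFinset_univ] at h
    rw [h, Finset.prod_const, Finset.card_univ, Fintype.card_fin]
  have hYsum : ∑ k : Fin 3 → Fin L, y k ≤ Real.exp (-(m * t / 2)) * B := by
    calc ∑ k : Fin 3 → Fin L, y k ≤ ∑ k : Fin 3 → Fin L, Real.exp (-(m * t / 2)) * ∏ j : Fin 3, w (k j) :=
          Finset.sum_le_sum fun k _ => hy_le k
      _ = Real.exp (-(m * t / 2)) * (∑ n : Fin L, w n) ^ 3 := by rw [← Finset.mul_sum, hprodsum]
      _ ≤ Real.exp (-(m * t / 2)) * B := by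
          rw [hB]
          refine mul_le_mul_of_nonneg_left ?_ (Real.exp_pos _).le
          exact pow_le_pow_left₀ (Finset.sum_nonneg fun n _ => hw0 n) hwsum 3
  -- STEP 1: `Π (1 − y)⁻¹ ≤ exp(2 Σ y)`
  have hprod_le : ∏ k : Fin 3 → Fin L, (1 - y k)⁻¹ ≤ Real.exp (2 * ∑ k : Fin 3 → Fin L, y k) := by
    rw [Finset.mul_sum, Real.exp_sum]
    refine Finset.prod_le_prod (fun k _ => ?_) (fun k _ => inv_one_sub_le_exp (hy0 k) (hy_half k))
    have : 0 < 1 - y k := by linarith [hy_half k]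
    positivity
  have hprod0 : 0 ≤ ∏ k : Fin 3 → Fin L, (1 - y k)⁻¹ :=
    Finset.prod_nonneg fun k _ => by
      have : 0 < 1 - y k := by linarith [hy_half k]
      positivity
  -- STEP 3/4: the exponent `z = 2 d Σ y ≤ 2 d B e^{−tm/2} ≤ ε'/4`
  set z : ℝ := (d : ℝ) * (2 * ∑ k : Fin 3 → Fin L, y k) with hz
  have hz0 : 0 ≤ z := by
    rw [hz]
    exact mul_nonneg (Nat.cast_nonneg _) (mul_nonneg (by norm_num) (Finset.sum_nonneg fun k _ => hy0 k))
  have hexpA : Real.exp (-(m * t / 2)) ≤ ε' / (4 * K) := by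
    have h1 : Real.exp (-(m * t / 2)) ≤ Real.exp (-(A / 2)) := Real.exp_le_exp.2 (by linarith)
    have h2 : Real.exp (-(A / 2)) ≤ Real.exp (-Real.log (4 * K / ε')) := Real.exp_le_exp.2 (by linarith)
    have h3 : Real.exp (-Real.log (4 * K / ε')) = ε' / (4 * K) := by
      rw [Real.exp_neg, Real.exp_log (by positivity)]
      field_simp
    linarith [h3.le]
  have hz_le : z ≤ ε' / 4 := by
    have h1 : z ≤ 2 * d * B * Real.exp (-(m * t / 2)) := by
      rw [hz]
      have hd0 : (0 : ℝ) ≤ d := Nat.cast_nonneg _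
      nlinarith [mul_le_mul_of_nonneg_left hYsum (by positivity : (0:ℝ) ≤ 2 * d)]
    have h2 : 2 * d * B * Real.exp (-(m * t / 2)) ≤ 2 * d * B * (ε' / (4 * K)) :=
      mul_le_mul_of_nonneg_left hexpA (by positivity)
    have h3 : 2 * (d : ℝ) * B ≤ K := by rw [hK]; linarith
    have h4 : 2 * d * B * (ε' / (4 * K)) ≤ ε' / 4 := by
      rw [mul_div_assoc']
      rw [div_le_div_iff₀ (by positivity) (by norm_num : (0:ℝ) < 4)]
      nlinarith [hε'0.le]
    linarith
  have hz1 : |z| ≤ 1 := by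
    rw [abs_of_nonneg hz0]
    linarith
  -- STEP 5: assemble
  have hmain : gaussTowerExcess d m c L t ≤ Real.exp z - 1 := by
    unfold gaussTowerExcess
    have h1 : (∏ k : Fin 3 → Fin L, (1 - Real.exp (-((t : ℝ) * latticeDispersion m c L k)))⁻¹) ^ d
        ≤ (Real.exp (2 * ∑ k : Fin 3 → Fin L, y k)) ^ d := pow_le_pow_left₀ hprod0 hprod_le d
    have h2 : (Real.exp (2 * ∑ k : Fin 3 → Fin L, y k)) ^ d = Real.exp z := by
      rw [hz, ← Real.exp_nat_mul]
    linarith [h2.le, h2.ge]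
  have hfinal : Real.exp z - 1 ≤ ε := by
    have h := Real.abs_exp_sub_one_le hz1
    have h' : Real.exp z - 1 ≤ 2 * |z| := le_trans (le_abs_self _) h
    rw [abs_of_nonneg hz0] at h'
    linarith
  exact le_trans hmain hfinal

/-! ## §2 The transferred crux: WHOLE-TOWER DOMINATION in the floor's unit, cofinally (T-DOM) -/

/-- **T-DOM `TowerDominatedCofinal` — the crux idea's `C⁺`.**  For simply-connected compact simple `G`, every `r`, every
positive unit `a → 0` carrying the floor `LowerBounds G r a`: there are a species count `d`, a light-speed margin `c > 0`,
a mass `μ > 0` IN FLOOR UNITS and `T₀` such that for every `T ≥ T₀`, COFINALLY in `β`, some torus of physical side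
`a(β)·L ∈ [T, 2T]` (`L ≥ 8`, `⌊L/4⌋ = m+2`) has its Doob thermal tower at the cold time dominated by the free massive tower of
mass `μ·a(β)`:  `x_{m+2}(L) ≤ gaussTowerExcess d (μ·a(β)) c L (m+2)`.
MECHANISM (not typed here): Lipschitz transport `γ_{M,ω_{μa(β),c}} → π_{β,L}` + E. Milman's contraction ⇒ spectrum theorem.
WHY IT MIGHT FAIL: `−log Ω₊²` need not be convex (relative to the massive Gaussian) on the Coulomb chart away from the
perturbative region; the Wilson transfer matrix is discrete-time (Doob dictionary exact only for Schrödinger-form `H`);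
`U(1)`: `κ_IR = 0` (no horizon term) — consistent with `not_coldExitAllGroups_of_u1TorusMassless`; `SO(3)`: multimodal
chart (twisted flat sectors) — consistent with `not_coldExitSimple_of_lightFluxMode_SO3`; floor deleted ⇒ no unit ⇒
`not_pinnedExitsCofinalFree` is honoured because `μ` is stated in the floor's unit `a`. -/
def TowerDominatedCofinal : Prop :=
  ∀ (G : Type) [Group G] [TopologicalSpace G] [IsTopologicalGroup G] [CompactSpace G],
    IsCompactSimpleLieGroup G → SimplyConnectedSpace G →
    letI : MeasurableSpace G := borel G
    haveI : BorelSpace G := ⟨rfl⟩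
    ∀ (r : LatticeRep G) (a : ℝ → ℝ), (∀ β, 0 < a β) → Tendsto a atTop (𝓝 0) → LowerBounds G r a →
      ∃ (d : ℕ) (c μ T₀ : ℝ), 0 < c ∧ 0 < μ ∧ ∀ T : ℝ, T₀ ≤ T → ∀ β₁ : ℝ, ∃ β : ℝ, β₁ ≤ β ∧ 0 ≤ β ∧
        ∃ (L : ℕ) (_ : NeZero L) (m : ℕ), L / 4 = m + 2 ∧ 8 ≤ L ∧ T ≤ a β * (L : ℝ) ∧ a β * (L : ℝ) ≤ 2 * T ∧
          traceExcess r.ρ β L (m + 2) ≤ gaussTowerExcess d (μ * a β) c L (m + 2)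

/-- **FIRST LEMMA B — the SEAM (kernel-checked): T-DOM ⇒ PXcof(1/24)** (`= RunningLandmark.PinnedExitsCofinalAt (1/24)`,
byte-identical with the slot's `PinnedCofinalBill.PinnedExitsCofinalAt (1/24)`).  Choose `T = max T₀ (7|A|/μ)` with
`A = A(d, c, 1/48)`; on the dominated torus `μ a(β) ⌊L/4⌋ ≥ μ·(a(β)L)·5/32 ≥ 35|A|/32 ≥ A`, so the free tower is `≤ 1/48`,
hence `x ≤ 1/48` and `δᶜ ≤ 2x ≤ 1/24` (`one_sub_ratio_le_two_mul_traceExcess`); the pinned side is `a(β)L ≤ 2T`. -/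
theorem pinnedExitsCofinal_of_towerDominated (h : TowerDominatedCofinal) : PinnedExitsCofinalAt (1 / 24) := by
  intro G _ _ _ _ hG hsc
  letI : MeasurableSpace G := borel G
  haveI : BorelSpace G := ⟨rfl⟩
  intro r a ha ha0 hlb
  obtain ⟨d, c, μ, T₀, hc, hμ, hdom⟩ := h G hG hsc r a ha ha0 hlb
  obtain ⟨A, hA⟩ := gaussTowerExcess_small d c hc (1 / 48) (by norm_num)
  set T : ℝ := max T₀ (7 * |A| / μ) with hTdef
  refine ⟨2 * T, fun β₁ => ?_⟩
  obtain ⟨β, hβ₁, hβ0, L, instL, m, hLm, hL8, hTle, hleT, hx⟩ := hdom T (le_max_left _ _) β₁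
  refine ⟨β, hβ₁, L, hL8, hleT, ?_⟩
  have haβ : 0 < a β := ha β
  -- arithmetic: `A ≤ μ a(β) ⌊L/4⌋`
  have hL4 : ((L : ℝ) - 3) / 4 ≤ ((L / 4 : ℕ) : ℝ) := by
    have h1 : L ≤ 4 * (L / 4) + 3 := by omega
    have h2 : (L : ℝ) ≤ 4 * ((L / 4 : ℕ) : ℝ) + 3 := by exact_mod_cast h1
    linarith
  have hL8r : (8 : ℝ) ≤ L := by exact_mod_cast hL8
  have hT7 : 7 * |A| / μ ≤ T := le_max_right _ _
  have h7 : 7 * |A| ≤ μ * T := by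
    rw [div_le_iff₀ hμ] at hT7
    linarith [hT7]
  have hmt : A ≤ μ * a β * ((L / 4 : ℕ) : ℝ) := by
    have s1 : μ * a β * (((L : ℝ) - 3) / 4) ≤ μ * a β * ((L / 4 : ℕ) : ℝ) :=
      mul_le_mul_of_nonneg_left hL4 (by positivity)
    have s2 : 5 * (a β * (L : ℝ)) / 32 ≤ a β * (((L : ℝ) - 3) / 4) := by nlinarith
    have s3 : μ * (5 * (a β * (L : ℝ)) / 32) ≤ μ * (a β * (((L : ℝ) - 3) / 4)) :=
      mul_le_mul_of_nonneg_left s2 hμ.le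
    have s4 : μ * (5 * T / 32) ≤ μ * (5 * (a β * (L : ℝ)) / 32) :=
      mul_le_mul_of_nonneg_left (by linarith) hμ.le
    have s5 : A ≤ |A| := le_abs_self A
    nlinarith [s1, s3, s4, s5, h7, abs_nonneg A]
  have htower : gaussTowerExcess d (μ * a β) c L (m + 2) ≤ 1 / 48 := by
    have := hA L (μ * a β) hL8 (by positivity) hmt
    rwa [hLm] at this
  haveI : NeZero L := instL
  have h2 := one_sub_ratio_le_two_mul_traceExcess r hβ0 L m
  show 1 - wilsonFinTorusPartition r.ρ β L L L (2 * (L / 4)) / wilsonFinTorusPartition r.ρ β L L L (L / 4) ^ 2 ≤ 1 / 24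
  rw [hLm]
  linarith [h2, hx, htower]

/-! ## §3 (answer to CUT-1, critic ymfull-r2c-crit-1: T-DOM struck as COSTUME via `pinnedExitsCofinalAt24_iff_traceExcessForm` +
the zero mode) — RE-TYPING as LEVEL-WISE DOMINATION, the transport lever's ACTUAL output

Why T-DOM was a costume: the tree law (p681246) `x_{k+2}(P) ≤ e^{−c·a(β)·(k+2)}` (all boxes `a(β)P ≥ T`, all cold times, cofinally)
is PXcof(1/24) itself, and a single zero mode of the reference tower dominates `e^{−tμa(β)}` — so a ONE-TIME trace bound by ANY
dispersion-carrying reference with a zero mode is interderivable with PXcof.  The lever (1-Lipschitz transport `γ → π` + E. Milman's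
contraction principle, arXiv:1508.00606 Thm 1.7) does not output a trace bound: it outputs `λ_k(π) ≥ λ_k(γ)` for EVERY `k` — domination
of the COUNTING FUNCTION `N_YM(E) = #{i : E_i ≤ E} ≤ N_ref(E) = #{g : E_ref(g) ≤ E}` at every energy.  That is typed below over the
tree's spectral idiom `IsRatioDatum` (statements quantified over ALL ratio data are statements about the spectrum) in the equivalent
LEVEL-MATCHING form (Hall–Rado: an injection-on-support `i ↦ g(i)` with `E_i ≥ E_ref(g(i))` exists iff `N_YM ≤ N_ref` pointwise, the
admissible sets being finite because `ω ≥ μa(β) > 0`).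

NOT INTERDERIVABLE WITH PXcof (why the CUT-1 probe cannot be repeated): from the law one gets only `N_YM(E) ≤ 1 + e^{tE}·x_t ≤
1 + e^{(P/4)(E − c a(β))}` (best at the smallest cold time `t = P/4`), i.e. `log N_YM(E) ≲ (P/4)·E`, LINEAR in `E`; the free count is
`log N_ref(E) ≈ (4/3)(σ_ref P³)^{1/4} E^{3/4}` (Stefan–Boltzmann entropy of `d` lattice bosons), SUBLINEAR — so for `E` large the law ALLOWS far more states than the reference HAS: no trace law at cold times bounds the counting
function by the free one.  Conversely LW-DOM ⇒ (layer cake ∕ level matching, lemma B) all-times trace domination ⇒ (t = ⌊L/4⌋) T-DOM ⇒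
(seam §2) PXcof(1/24): STRONGER, with the why-easier that it is the one-stroke output of a named tool (contraction ⇒ whole spectrum),
which has no trace-level or gap-level weakening that is easier to reach by that tool.

PLAUSIBILITY LEDGER (where LW-DOM could be false though PXcof true — the honest extra exposure): (i) UV ∕ lattice scale: YM has
`2·d_𝔤` transverse modes per site with lattice frequencies `|k̂|(1 + O(g²))` → absorbed by `d ≥ 4 d_𝔤` species and the light-speed margin
`c ≤ 1/2` (reference levels LOWER ⇒ reference counts HIGHER); per-mode ultra-high levels are rotor-like on compact `G`
(`N ~ (βE)^{d_𝔤/2}` vs oscillator `E^{d_𝔤}`: FEWER states above `E ≳ β` per mode — right direction); (ii) deconfined window: needs the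
YM microcanonical entropy density below `(4/3)σ_ref^{1/4} e^{3/4}` with `σ_ref = (π²/30) d/c³` — true at high `e` iff `d/c³ > 2d_𝔤`
(pressure below its Stefan–Boltzmann limit, the lattice-thermodynamics consensus, NOT a theorem), and across the transition with slack
`(d/c³)^{1/4}`; (iii) Hagedorn window (confined, `E < e_c ℓ³`): `S ≈ E/T_H ≤ (4/3)(σ_ref ℓ³)^{1/4}E^{3/4}` iff `E ≤ 3.16 σ_ref T_H⁴ ℓ³` ✓
for `σ_ref ≥ 1`; (iv) torelon ∕ 't Hooft flux sectors `E ≈ σ·ℓ`: large on pinned boxes `ℓ ≥ T₀` (choose `T₀`, `μ` small); (v) IR: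
`μ ≤ M_{0⁺⁺}`, `c ≤ 1` put every glueball branch `√(M_j² + p²)` above a reference branch; (vi) COUNTING CLASS: LW-DOM forces
`N_YM(E) ≤ N_ref(E) = poly(E)` of degree `d·L³` for ALL `E` — no trace-class fact gives this (Hilbert–Schmidt only yields `N ≤ 1 + e^{2E}x₂`), but it is
the right class for the Wilson transfer operator: its kernel `e^{−βS}` is REAL-ANALYTIC on the compact analytic manifold `G^{3L³}` (dimension `D = 3d_𝔤L³`), and
analytic kernels have eigenvalues `λ_n ≤ C e^{−κ n^{1/D}}` (Little–Reade 1984 in 1D; König, Eigenvalue distribution of compact operators (1986) §3), i.e.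
`N_YM(E) ≲ (E + βC)^{D}`; in the rotor regime Weyl's law on `G^{3L³}` gives degree `D/2` — so `d ≥ 3d_𝔤` is FORCED (a concrete necessary condition on the
species count, recorded).  None of (i)–(vi) is available for `U(1)`
(massless photon branch BELOW any `μ > 0` reference: LW-DOM's `U(1)` analogue is FALSE, as it must be) nor for finite `G`
(frozen: `coldDefect → 1 − |G|⁻³`, lead p784277/p784633) — both excluded by the hypotheses, which is where simplicity ∕ positive
dimension enter. -/

/-- Free reference energy of an occupation function `g : (species × momentum) → ℕ`: `E_ref(g) = Σ_{(s,k)} g(s,k)·ω_{m,c}(k)`. -/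
def occupationEnergy (d : ℕ) (m c : ℝ) (L : ℕ) (g : Fin d × (Fin 3 → Fin L) → ℕ) : ℝ :=
  ∑ p : Fin d × (Fin 3 → Fin L), (g p : ℝ) * latticeDispersion m c L p.2

/-- **Level matching** of a ratio datum `rr` (ratios `λᵢ/λ₀ ∈ [0,1]`) into the free tower of `d` species, mass `m`, light speed `c`
on `L³`: occupation functions assigned to levels, injectively on the support `{i | rr i ≠ 0}` (the kernel of the transfer matrix —
non-singlet states — is free), with EVERY level at least its reference level: `rr i ≤ e^{−E_ref(f i)}`, i.e. `E_i = −log rr_i ≥ E_ref(f i)`.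
Equivalent (Hall–Rado, finite admissible sets since `ω ≥ m > 0`) to `#{i : E_i ≤ E} ≤ #{g : E_ref(g) ≤ E}` for every `E` — E. Milman's
`λ_k(π) ≥ λ_k(γ) ∀k` read through the Doob dictionary.  The vacuum is forced to `f i₀ = 0`. -/
def LevelMatched {ι : Type} (rr : ι → ℝ) (d : ℕ) (m c : ℝ) (L : ℕ) : Prop :=
  ∃ f : ι → (Fin d × (Fin 3 → Fin L) → ℕ), Set.InjOn f {i | rr i ≠ 0} ∧
    ∀ i, rr i ≤ Real.exp (-(occupationEnergy d m c L (f i)))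

/-- **LW-DOM `LevelwiseDominatedCofinal` — the re-typed piece (replaces T-DOM as the card's load-bearing statement).**
For simply-connected compact simple `G`, every `r`, every positive unit `a → 0` carrying the floor: there are a species count `d`,
a light-speed margin `c > 0`, a mass `μ > 0` IN FLOOR UNITS and `T₀` such that for every `T ≥ T₀`, COFINALLY in `β`, some pinned torus
`a(β)L ∈ [T, 2T]`, `L ≥ 8`, has its WHOLE transfer-matrix spectrum level-matched into the free tower of mass `μ·a(β)`: for EVERY ratio
datum of `(r.ρ, β, L)` (tree idiom `IsRatioDatum`; the tree supplies one, `exists_ratioDatum`), `LevelMatched rr d (μ·a(β)) c L`.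
STRONGER than PXcof(1/24) (`pinnedExitsCofinal_of_levelwise` below, KERNEL, no sorry) and NOT implied by
it (module docstring §3: the law's count bound is linear in `E`, the free count sublinear).  MECHANISM: 1-Lipschitz transport
`γ_{M,ω_{μa(β),c}} → π_{β,L}` on Zwanziger's convex Coulomb chart + E. Milman's contraction principle (levelwise, one stroke) + the
discrete-time Doob dictionary (DT).  WHY IT MIGHT FAIL: as T-DOM ((K) chart log-concavity off the perturbative region; (DT)); plus the
extra exposure (i)–(vi) of the module docstring (UV mode count ∕ speed margin, deconfined entropy vs Stefan–Boltzmann, Hagedorn window,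
flux sectors, IR masses, polynomial counting class with `d ≥ 3d_𝔤` forced) — each met by the free constants `d, c, μ, T₀`, none by a theorem. -/
def LevelwiseDominatedCofinal : Prop :=
  ∀ (G : Type) [Group G] [TopologicalSpace G] [IsTopologicalGroup G] [CompactSpace G],
    IsCompactSimpleLieGroup G → SimplyConnectedSpace G →
    letI : MeasurableSpace G := borel G
    haveI : BorelSpace G := ⟨rfl⟩
    ∀ (r : LatticeRep G) (a : ℝ → ℝ), (∀ β, 0 < a β) → Tendsto a atTop (𝓝 0) → LowerBounds G r a →
      ∃ (d : ℕ) (c μ T₀ : ℝ), 0 < c ∧ 0 < μ ∧ ∀ T : ℝ, T₀ ≤ T → ∀ β₁ : ℝ, ∃ β : ℝ, β₁ ≤ β ∧ 0 ≤ β ∧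
        ∃ (L : ℕ) (_ : NeZero L), 8 ≤ L ∧ T ≤ a β * (L : ℝ) ∧ a β * (L : ℝ) ≤ 2 * T ∧
          ∀ (ι : Type) [DecidableEq ι] (rr : ι → ℝ) (i₀ : ι), IsRatioDatum r.ρ β L ι rr i₀ →
            LevelMatched rr d (μ * a β) c L

/-- The dispersion is at least the mass (`m ≥ 0`). -/
theorem mass_le_latticeDispersion' {m : ℝ} (hm : 0 ≤ m) (c : ℝ) (L : ℕ) (k : Fin 3 → Fin L) :
    m ≤ latticeDispersion m c L k := by
  unfold latticeDispersion
  calc m = Real.sqrt (m ^ 2) := (Real.sqrt_sq hm).symm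
    _ ≤ Real.sqrt (m ^ 2 + c ^ 2 * ∑ j : Fin 3, (2 * Real.sin (Real.pi * ((k j : ℕ) : ℝ) / L)) ^ 2) := by
        apply Real.sqrt_le_sqrt
        have : 0 ≤ c ^ 2 * ∑ j : Fin 3, (2 * Real.sin (Real.pi * ((k j : ℕ) : ℝ) / L)) ^ 2 := by positivity
        linarith

/-- The occupation energy is nonnegative (`m ≥ 0`). -/
theorem occupationEnergy_nonneg (d : ℕ) {m : ℝ} (hm : 0 ≤ m) (c : ℝ) (L : ℕ) (g : Fin d × (Fin 3 → Fin L) → ℕ) :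
    0 ≤ occupationEnergy d m c L g := by
  unfold occupationEnergy
  exact Finset.sum_nonneg fun p _ => mul_nonneg (Nat.cast_nonneg _) (hm.trans (mass_le_latticeDispersion' hm c L p.2))

/-- A non-zero occupation has energy at least the mass (`m ≥ 0`), hence positive energy when `m > 0`. -/
theorem mass_le_occupationEnergy (d : ℕ) {m : ℝ} (hm : 0 ≤ m) (c : ℝ) (L : ℕ) {g : Fin d × (Fin 3 → Fin L) → ℕ}
    (hg : g ≠ 0) : m ≤ occupationEnergy d m c L g := by
  obtain ⟨p, hp⟩ : ∃ p, g p ≠ 0 := by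
    by_contra h
    push Not at h
    exact hg (funext h)
  unfold occupationEnergy
  have h1 : (1 : ℝ) ≤ (g p : ℝ) := by exact_mod_cast Nat.one_le_iff_ne_zero.mpr hp
  have hω : m ≤ latticeDispersion m c L p.2 := mass_le_latticeDispersion' hm c L p.2
  calc m ≤ (g p : ℝ) * latticeDispersion m c L p.2 := by nlinarith
    _ ≤ ∑ q : Fin d × (Fin 3 → Fin L), (g q : ℝ) * latticeDispersion m c L q.2 := by
        apply Finset.single_le_sum (f := fun q => (g q : ℝ) * latticeDispersion m c L q.2) _ (Finset.mem_univ p)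
        intro q _
        exact mul_nonneg (Nat.cast_nonneg _) (hm.trans (mass_le_latticeDispersion' hm c L q.2))

/-- **Multi-geometric series over a finite index type (kernel):** for `0 ≤ x_q < 1`,
`Σ_{g : Q → ℕ} Π_q x_q^{g q} = Π_q (1 − x_q)⁻¹`.  Proof: the terms are nonnegative, every finite partial sum sits inside a box
`{g ≤ N}^Q` whose sum is `Π_q Σ_{n<N} x_q^n ≤ Π_q (1−x_q)⁻¹` (`Finset.sum_prod_piFinset`), and the box sums converge to the product
(`tendsto_finsetProd` of the geometric series); `hasSum_of_isLUB_of_nonneg`. -/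
theorem hasSum_pi_geometric {Q : Type} [Fintype Q] (x : Q → ℝ) (hx0 : ∀ q, 0 ≤ x q) (hx1 : ∀ q, x q < 1) :
    HasSum (fun g : Q → ℕ => ∏ q, x q ^ g q) (∏ q, (1 - x q)⁻¹) := by
  classical
  set a : ℝ := ∏ q, (1 - x q)⁻¹ with ha
  set F : ℕ → ℝ := fun N => ∏ q, ∑ n ∈ Finset.range N, x q ^ n with hF
  have hterm_nn : ∀ g : Q → ℕ, 0 ≤ ∏ q, x q ^ g q := fun g => Finset.prod_nonneg fun q _ => pow_nonneg (hx0 q) _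
  have hbox : ∀ N, ∑ g ∈ Fintype.piFinset (fun _ : Q => Finset.range N), ∏ q, x q ^ g q = F N :=
    fun N => Finset.sum_prod_piFinset (Finset.range N) (fun q n => x q ^ n)
  have hgeom : ∀ q, HasSum (fun n : ℕ => x q ^ n) (1 - x q)⁻¹ :=
    fun q => hasSum_geometric_of_lt_one (hx0 q) (hx1 q)
  have hfac_le : ∀ q N, ∑ n ∈ Finset.range N, x q ^ n ≤ (1 - x q)⁻¹ :=
    fun q N => sum_le_hasSum (Finset.range N) (fun n _ => pow_nonneg (hx0 q) n) (hgeom q)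
  have hfac_nn : ∀ q N, 0 ≤ ∑ n ∈ Finset.range N, x q ^ n :=
    fun q N => Finset.sum_nonneg fun n _ => pow_nonneg (hx0 q) n
  have hF_le : ∀ N, F N ≤ a := fun N => Finset.prod_le_prod (fun q _ => hfac_nn q N) (fun q _ => hfac_le q N)
  have hF_tend : Tendsto F atTop (𝓝 a) :=
    tendsto_finsetProd Finset.univ (fun q _ => (hgeom q).tendsto_sum_nat)
  have hsub : ∀ S : Finset (Q → ℕ), ∃ N, S ⊆ Fintype.piFinset (fun _ : Q => Finset.range N) := by
    intro S
    refine ⟨(S.sup fun g => Finset.univ.sup g) + 1, fun g hg => ?_⟩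
    rw [Fintype.mem_piFinset]
    intro q
    rw [Finset.mem_range]
    have h1 : g q ≤ Finset.univ.sup g := Finset.le_sup (f := g) (Finset.mem_univ q)
    have h2 : Finset.univ.sup g ≤ S.sup fun g => Finset.univ.sup g :=
      Finset.le_sup (f := fun g : Q → ℕ => Finset.univ.sup g) hg
    omega
  have hpart_le : ∀ S : Finset (Q → ℕ), ∑ g ∈ S, ∏ q, x q ^ g q ≤ a := by
    intro S
    obtain ⟨N, hN⟩ := hsub S
    calc ∑ g ∈ S, ∏ q, x q ^ g q ≤ ∑ g ∈ Fintype.piFinset (fun _ : Q => Finset.range N), ∏ q, x q ^ g q :=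
          Finset.sum_le_sum_of_subset_of_nonneg hN fun g _ _ => hterm_nn g
      _ = F N := hbox N
      _ ≤ a := hF_le N
  refine hasSum_of_isLUB_of_nonneg a hterm_nn ⟨?_, ?_⟩
  · rintro _ ⟨S, rfl⟩
    exact hpart_le S
  · intro b hb
    have hFb : ∀ N, F N ≤ b := fun N => by
      have := hb (Set.mem_range_self (Fintype.piFinset (fun _ : Q => Finset.range N)))
      rw [← hbox N]
      exact this
    exact le_of_tendsto' hF_tend hFb

/-- **LEMMA B1 (kernel): the free tower IS the multi-geometric series.**  For `m > 0`, `s > 0`: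
`Σ_{g : (species × momentum) → ℕ} e^{−s·E_ref(g)} = Π_{(s',k)} (1 − e^{−s ω(k)})⁻¹ = (Π_k (1 − e^{−s ω(k)})⁻¹)^d` — the partition function of
`d·L³` independent geometric modes (`e^{−sω(k)} < 1` since `ω ≥ m > 0`). -/
theorem hasSum_occupation (d : ℕ) {m : ℝ} (hm : 0 < m) (c : ℝ) (L : ℕ) {s : ℝ} (hs : 0 < s) :
    HasSum (fun g : (Fin d × (Fin 3 → Fin L) → ℕ) => Real.exp (-(s * occupationEnergy d m c L g)))
      ((∏ k : Fin 3 → Fin L, (1 - Real.exp (-(s * latticeDispersion m c L k)))⁻¹) ^ d) := by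
  classical
  have key := hasSum_pi_geometric (Q := Fin d × (Fin 3 → Fin L))
    (fun p => Real.exp (-(s * latticeDispersion m c L p.2)))
    (fun p => (Real.exp_pos _).le)
    (fun p => by
      have hω : 0 < s * latticeDispersion m c L p.2 :=
        mul_pos hs (hm.trans_le (mass_le_latticeDispersion' hm.le c L p.2))
      have : -(s * latticeDispersion m c L p.2) < 0 := by linarith
      exact lt_of_lt_of_eq (Real.exp_lt_exp.2 this) Real.exp_zero)
  have h1 : (fun g : (Fin d × (Fin 3 → Fin L) → ℕ) => Real.exp (-(s * occupationEnergy d m c L g)))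
      = fun g => ∏ p, Real.exp (-(s * latticeDispersion m c L p.2)) ^ g p := by
    funext g
    unfold occupationEnergy
    rw [Finset.mul_sum, ← Finset.sum_neg_distrib, Real.exp_sum]
    refine Finset.prod_congr rfl fun p _ => ?_
    rw [← Real.exp_nat_mul]
    congr 1
    ring
  have h2 : (∏ p : Fin d × (Fin 3 → Fin L), (1 - Real.exp (-(s * latticeDispersion m c L p.2)))⁻¹)
      = (∏ k : Fin 3 → Fin L, (1 - Real.exp (-(s * latticeDispersion m c L k)))⁻¹) ^ d := by
    rw [Fintype.prod_prod_type]
    simp only [Finset.prod_const, Finset.card_univ, Fintype.card_fin]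
  rw [h1, ← h2]
  exact key

/-- **LEMMA B (spectral bookkeeping, KERNEL — no sorry): a level matching dominates every trace.**  For a ratio datum and a level
matching into a tower with `m > 0`: `x_{t+2} = Σ_{i ≠ i₀} rrᵢ^{t+2} ≤ Σ_{i ≠ i₀, rrᵢ ≠ 0} e^{−(t+2)E_ref(f i)} ≤ Σ_{g ≠ 0} e^{−(t+2)E_ref(g)}
= (Π_k (1 − e^{−(t+2)ω(k)})⁻¹)^d − 1`: restrict to the support (off it `rrᵢ^{t+2} = 0`), where `f` is injective and misses `0` (`f i₀ = 0` is
forced by `rr i₀ = 1` and `E_ref > 0` off `0`), compare termwise, and bound the injective sub-sum by the full sum minus the vacuum term. -/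
theorem traceExcess_le_gaussTowerExcess_of_levelMatched
    {G : Type} [Group G] [TopologicalSpace G] [IsTopologicalGroup G] [CompactSpace G] [MeasurableSpace G] [BorelSpace G]
    {n : ℕ} {ρ : G →* Matrix (Fin n) (Fin n) ℂ} {β : ℝ} {L : ℕ} [NeZero L]
    {ι : Type} [DecidableEq ι] {rr : ι → ℝ} {i₀ : ι} (hd : IsRatioDatum ρ β L ι rr i₀)
    {d : ℕ} {m c : ℝ} (hm : 0 < m) (hmatch : LevelMatched rr d m c L) (t : ℕ) :
    traceExcess ρ β L (t + 2) ≤ gaussTowerExcess d m c L (t + 2) := by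
  classical
  obtain ⟨hr, h1, hsum⟩ := hd
  obtain ⟨f, hinj, hle⟩ := hmatch
  set s : ℝ := ((t + 2 : ℕ) : ℝ) with hsdef
  have hs : 0 < s := by rw [hsdef]; positivity
  -- the reference weights and their sum
  set w : (Fin d × (Fin 3 → Fin L) → ℕ) → ℝ := fun g => Real.exp (-(s * occupationEnergy d m c L g)) with hwdef
  set P : ℝ := (∏ k : Fin 3 → Fin L, (1 - Real.exp (-(s * latticeDispersion m c L k)))⁻¹) ^ d with hPdef
  have hw : HasSum w P := hasSum_occupation d hm c L hs
  have hw0 : w 0 = 1 := by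
    simp [hwdef, occupationEnergy]
  -- the vacuum-removed reference family
  set w' : (Fin d × (Fin 3 → Fin L) → ℕ) → ℝ := fun g => if g = 0 then 0 else w g with hw'def
  have hw' : HasSum w' (P - 1) := by
    have := hasSum_ite_sub_hasSum hw 0
    rw [hw0] at this
    exact this
  have hw'nn : ∀ g, 0 ≤ w' g := by
    intro g; simp only [hw'def]; split_ifs
    · exact le_rfl
    · exact (Real.exp_pos _).le
  -- f i₀ = 0
  have hfi0 : f i₀ = 0 := by
    by_contra hne
    have hE : m ≤ occupationEnergy d m c L (f i₀) := mass_le_occupationEnergy d hm.le c L hne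
    have h2 := hle i₀
    rw [h1] at h2
    have : Real.exp (-(occupationEnergy d m c L (f i₀))) < 1 := by
      rw [← Real.exp_zero]; exact Real.exp_lt_exp.2 (by linarith)
    linarith
  -- the spectral family u and its termwise bound on the support
  set u : ι → ℝ := Function.update (fun i => rr i ^ (t + 2)) i₀ 0 with hudef
  have hu : HasSum u (traceExcess ρ β L (t + 2)) := hsum t
  set S : Set ι := {i | rr i ≠ 0} with hSdef
  have hi0S : i₀ ∈ S := by simp [hSdef, h1]
  have hfS : ∀ i ∈ S, i ≠ i₀ → f i ≠ 0 := by
    intro i hi hne hfi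
    exact hne (hinj hi hi0S (hfi.trans hfi0.symm))
  have hle' : ∀ i : S, u i ≤ w' (f i) := by
    rintro ⟨i, hi⟩
    by_cases hii : i = i₀
    · subst hii
      simp [hudef, hfi0, hw'def]
    · have hfi : f i ≠ 0 := hfS i hi hii
      simp only [hudef, Function.update_of_ne hii, hw'def, if_neg hfi, hwdef]
      have h3 : rr i ^ (t + 2) ≤ Real.exp (-(occupationEnergy d m c L (f i))) ^ (t + 2) :=
        pow_le_pow_left₀ (hr i).1 (hle i) _
      have h4 : Real.exp (-(occupationEnergy d m c L (f i))) ^ (t + 2) =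
          Real.exp (-(s * occupationEnergy d m c L (f i))) := by
        rw [← Real.exp_nat_mul, hsdef]; ring_nf
      linarith [h3, h4.le]
  -- u vanishes off the support, so its sum is the sum over the support
  have huS : ∀ i, i ∉ S → u i = 0 := by
    intro i hi
    have hri : rr i = 0 := by simpa [hSdef] using hi
    by_cases hii : i = i₀
    · subst hii; simp [hudef]
    · simp [hudef, Function.update_of_ne hii, hri]
  have hu_ind : S.indicator u = u := by
    funext i
    by_cases hi : i ∈ S
    · simp [Set.indicator_of_mem hi]
    · simp [Set.indicator_of_notMem hi, huS i hi]
  have hsumS : ∑' i : S, u i = traceExcess ρ β L (t + 2) := by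
    rw [tsum_subtype S u, hu_ind, hu.tsum_eq]
  -- injectivity of f on the support, summability of the compared families
  have hinj' : Function.Injective (fun i : S => f i) := by
    rintro ⟨i, hi⟩ ⟨j, hj⟩ hij
    exact Subtype.ext (hinj hi hj hij)
  have hsw' : Summable (fun i : S => w' (f i)) := hw'.summable.comp_injective hinj'
  have hsu : Summable (fun i : S => u i) := hu.summable.subtype S
  have step1 : ∑' i : S, u i ≤ ∑' i : S, w' (f i) := hsu.tsum_le_tsum hle' hsw'
  have step2 : ∑' i : S, w' (f i) ≤ ∑' g, w' g :=
    tsum_comp_le_tsum_of_inj hw'.summable hw'nn hinj'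
  have step3 : ∑' g, w' g = P - 1 := hw'.tsum_eq
  -- assemble
  have hgoal : traceExcess ρ β L (t + 2) ≤ P - 1 := by
    rw [← hsumS]; linarith [step1, step2, step3.le, step3.ge]
  have hP : gaussTowerExcess d m c L (t + 2) = P - 1 := by
    simp only [gaussTowerExcess, hPdef, hsdef]
  rw [hP]; exact hgoal

/-- **LW-DOM ⇒ T-DOM (KERNEL, sorry-free since v2.2):** instantiate the tree's ratio datum (`exists_ratioDatum`) on the pinned torus and read
the matched tower at the cold time `⌊L/4⌋`. -/
theorem towerDominated_of_levelwise (h : LevelwiseDominatedCofinal) : TowerDominatedCofinal := by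
  intro G _ _ _ _ hG hsc
  letI : MeasurableSpace G := borel G
  haveI : BorelSpace G := ⟨rfl⟩
  intro r a ha ha0 hlb
  obtain ⟨d, c, μ, T₀, hc, hμ, hdom⟩ := h G hG hsc r a ha ha0 hlb
  refine ⟨d, c, μ, T₀, hc, hμ, fun T hT β₁ => ?_⟩
  obtain ⟨β, hβ₁, hβ0, L, instL, hL8, hTle, hleT, hlw⟩ := hdom T hT β₁
  haveI : NeZero L := instL
  haveI : SecondCountableTopology G :=
    (r.continuous.isClosedEmbedding r.injective).isEmbedding.secondCountableTopology
  obtain ⟨ι, hdec, rr, i₀, hrd⟩ := exists_ratioDatum r hβ0 L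
  refine ⟨β, hβ₁, hβ0, L, instL, L / 4 - 2, by omega, hL8, hTle, hleT, ?_⟩
  have hm : 0 < μ * a β := mul_pos hμ (ha β)
  exact traceExcess_le_gaussTowerExcess_of_levelMatched hrd hm (hlw ι rr i₀ hrd) (L / 4 - 2)

/-- **The re-typed chain (KERNEL, sorry-free since v2.3): LW-DOM ⇒ PXcof(1/24)** — concludes the slot's first stub BY NAME
(`RunningLandmark.PinnedExitsCofinalAt (1/24)`, byte-identical with `PinnedCofinalBill.PinnedExitsCofinalAt (1/24)`). -/
theorem pinnedExitsCofinal_of_levelwise (h : LevelwiseDominatedCofinal) : PinnedExitsCofinalAt (1 / 24) :=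
  pinnedExitsCofinal_of_towerDominated (towerDominated_of_levelwise h)

end Summit.QuantumFields.YangMills.Cruxes.IRcof.Lens4Spectral

end
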